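import Mathlib.Geometry.Euclidean.Volume.Measure
import Mathlib.MeasureTheory.Integral.Lebesgue.Basic
import Literature.Geometry.Lorentzian.LeviCivita
import Literature.Geometry.Lorentzian.KerrConvergence
import HarnessLib

/-!
# The Killing defect (deformation tensor) of a vector field and `ε`-stationarity on chart slabs

For a `C^n` pseudo-Riemannian metric `g` on `TM` with its Levi-Civita connection `∇`
(`LeviCivita.lean`) and a vector field `T` on `M` we define, pointwise as continuous bilinear
forms on `T_x M`,

* `g.deformationTensor T x` — the **deformation tensor** `π = ⁽ᵀ⁾π = 𝓛_T g`,
  `π(V, W) = g(∇_V T, W) + g(V, ∇_W T)` (Christodoulou–Klainerman 1993, Ch. 1, "`π` is the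
  deformation tensor of `X`, that is `π = 𝓛_X g`"; Wald 1984, (C.2.16):
  `𝓛_v g_{ab} = ∇_a v_b + ∇_b v_a`); `T` is a Killing field iff it is `C^n` and `π = 0`
  (O'Neill 1983, Ch. 9, Def. 9.22 and Prop. 9.25; `isKillingField_iff_deformationTensor_eq_zero`),
  so `π` is the **Killing defect** of `T`;
* `g.killingTwoForm T x` — the **Killing `2`-form** `K = d(T♭)`,
  `K(V, W) = g(∇_V T, W) − g(V, ∇_W T)`, i.e. `K_{ab} = ∇_a T_b − ∇_b T_a = 2 ∇_{[a} T_{b]}`, the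
  integrand of Komar's integral (Wald 1984, (11.2.5)–(11.2.9): `∮_S ε_{abcd} ∇^c ξ^d`); one has
  `π + K = 2 g(∇T, ·)` (`deformationTensor_add_killingTwoForm`);

and, for a spacetime `𝓢 : Spacetime 4`, a reference background `B : ModelBackground` with a chart
map `Ψ : B.domain → 𝓢.carrier` (meant: a late-time chart, `Spacetime.IsLateChart`,
`KerrConvergence.lean`) and a vector field `T` on `𝓢`,

* `𝓢.killingDefect T` — the deformation tensor of `T` for `𝓢.metric` (specialisation);
* `𝓢.chartKillingDefect B Ψ T x : E4 →L[ℝ] E4 →L[ℝ] ℝ` — the chart components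
  `(Ψ^* π)(x)(v, w) = π_{Ψ x}(dΨ v, dΨ w)` of `π` at `x ∈ B.domain ⊆ E4` (`pullbackBilin`), and its
  extension by zero `𝓢.chartKillingDefectExtend B Ψ T : E4 → _` (so that `iteratedFDeriv ℝ m`
  applies, exactly as `Spacetime.deviationExtend`);
* `𝓢.killingDefectCk B Ψ T k R τ : ℝ≥0∞` — the `Cᵏ` sup norm
  `sup_{m ≤ k} sup ‖D^m (Ψ^* π)‖` over the truncated coordinate slab `{t = τ, r ≤ R}`
  (`ModelBackground.truncTimeSlab`, `supCkENorm`);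
* `𝓢.killingDefectL1 B Ψ T w k R τ : ℝ≥0∞` — the weighted `W^{k,1}` size
  `∫_{t = τ, r ≤ R} w · ∑_{m ≤ k} ‖D^m (Ψ^* π)‖ dμHE[3]` of the chart components over the same slab,
  with respect to the (Euclidean-normalised) `3`-dimensional Hausdorff measure `μHE[3]` of the
  coordinate slab in `E4` and a weight `w : E4 → ℝ≥0∞`;
* the predicates `𝓢.IsEpsStationaryOn B Ψ T k R τ ε` (`T` is smooth and
  `killingDefectCk … k R τ ≤ ε`; the requested notion is `k = 1`: the `C¹` sup norm of the chart
  components of `π`, i.e. of `π` and `∂π`, is at most `ε`) and `𝓢.IsEpsStationaryL1On B Ψ T w k R τ ε`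
  (the weighted `W^{k,1}` variant).

## Sources

* B. O'Neill, *Semi-Riemannian geometry*, Academic Press 1983, Ch. 9, Def. 22 (Killing vector
  field: `L_X g = 0`) and Prop. 25 with its proof (`(L_X g)(V, W) = ⟨D_V X, W⟩ + ⟨D_W X, V⟩`;
  `X` Killing iff `DX` is skew-adjoint).
* R. M. Wald, *General Relativity*, Chicago 1984, (C.2.16) (`𝓛_v g_{ab} = ∇_a v_b + ∇_b v_a`),
  (C.3.1) (Killing's equation), (11.2.5)–(11.2.9) (Komar's integral of `∇^{[c} ξ^{d]}`).
* D. Christodoulou, S. Klainerman, *The global nonlinear stability of the Minkowski space*,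
  Princeton 1993, Ch. 1 (deformation tensor `⁽ˣ⁾π = 𝓛_X g`; footnotes 22–23: Killing iff
  `⁽ˣ⁾π = 0`, "almost Killing" = deformation tensor small in an appropriate norm) and Ch. 7, §7.1.
* M. T. Anderson, *On stationary vacuum solutions to the Einstein equations*, Ann. Henri Poincaré
  1 (2000) 977–994, §0 (stationary: a timelike Killing field `X`, `𝓛_X g = 0`; Thm. 0.1).
* M. Dafermos, G. Holzegel, I. Rodnianski, M. Taylor, arXiv:2104.08222, §1 (pointwise `Cᵏ` norms
  on the slabs `{t* = τ} ∩ {r ≤ R}` of a late-time chart — the frame of `KerrConvergence.lean`).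

## Design choices

* **Generality.** `deformationTensor` and `killingTwoForm` live at the generality of
  `PseudoRiemannianMetric.IsKillingField` (any `C^n` metric with `[g.HasLeviCivita]`); only the
  size functionals are tied to `Spacetime 4` and the `E4`-charts of `ModelBackground`. The factor
  convention is Christodoulou–Klainerman's `π = 𝓛_T g` (Dafermos–Rodnianski use `½ 𝓛_T g`).
* **Continuous bilinear values.** `π_x`, `K_x` are continuous bilinear maps
  `T_x M →L[ℝ] T_x M →L[ℝ] ℝ` (built on the model space `E = T_x M` from `g.val x` and the
  continuous linear map `(∇T)_x = g.leviCivita T x`), so that they can be pulled back along chart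
  maps (`pullbackBilin`) and differentiated covariantly (`g.covDeriv₂`) like the metric itself.
  If `T` is not differentiable at `x`, `(∇T)_x` is the junk value `0` of `leviCivitaFun` and
  `π_x = K_x = 0`; this is why the `ε`-stationarity predicates record smoothness of `T`.
* **Coordinate norms, no new analysis.** The chart-level functionals copy `Spacetime.deviationCk` /
  `truncDeviationCk`: components in the global chart of `E4`, extension by zero off the open domain,
  Mathlib's `iteratedFDeriv`, `supCkENorm`. The `C¹` sup norm of the components of `π` controls `π`
  and `∂π`, hence `∇π = ∂π − Γ ⋆ π` wherever the Christoffel symbols of `Ψ^* g` are bounded (bounded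
  geometry of the slab is a separate hypothesis of the intended statements). The `L¹` variant
  integrates against `μHE[3]` on the coordinate slab (for `t = x⁰` a piece of a hyperplane, where
  `μHE[3]` is Lebesgue surface measure), with an arbitrary weight `w` (`w = 1`: plain `W^{k,1}`;
  radial weights `w = (1 + r)^s` for whole slabs `R = ∞` are the caller's choice).
* The chart `Ψ` is a parameter and carries no hypothesis here: the intended callers quantify over
  late-time charts (`IsLateChart`/`IsLateEmbedding`), under which `Ψ^* π` on the open domain is the
  honest coordinate expression of `π`. Likewise no causal-character or normalisation condition on
  `T` is built in ("uniformly timelike", "asymptotic to the time translation at the given order"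
  are separate hypotheses of the statements that use `IsEpsStationaryOn`; the `ε`-regularity use
  deliberately lets `T` degenerate).
* Not here: the Komar integral `∮_S K^{ab} dS_{ab}` and the Komar–KID divergence identity
  `∇_b K^{ab} = 2 R^a{}_b T^b − ∇_b π^{ab} + ∇^a tr π` (separate items), KIDs on initial data
  (Beig–Chruściel 1997) and Dain's invariant `λ(h, k)`.
-/

noncomputable section

open Bundle Set TopologicalSpace MeasureTheory
open scoped Manifold ContDiff Topology ENNReal

universe u

namespace Literature.Geometry.Lorentzian

variable {E : Type*} [NormedAddCommGroup E] [NormedSpace ℝ E] {H : Type*} [TopologicalSpace H]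
  {I : ModelWithCorners ℝ E H} {M : Type*} [TopologicalSpace M] [ChartedSpace H M]
  [IsManifold I ∞ M] {n : ℕ∞ω} {x : M}

namespace PseudoRiemannianMetric

variable (g : PseudoRiemannianMetric I n E (TangentSpace I : M → Type _)) [g.HasLeviCivita]

/-! ### The deformation tensor `π = 𝓛_T g` -/

/-- The **deformation tensor** (Killing defect) `π = ⁽ᵀ⁾π = 𝓛_T g` of a vector field `T` at `x`,
as a continuous bilinear form on `T_x M`: `π_x(V, W) = g_x(∇_V T, W) + g_x(V, ∇_W T)` with `∇`
the Levi-Civita connection of `g` (recall Mathlib's argument order `g.leviCivita T x V = ∇_V T`).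
Christodoulou–Klainerman 1993, Ch. 1 ("`π` is the deformation tensor of `X`, that is
`π = 𝓛_X g`") and Ch. 7, §7.1; the formula `(𝓛_T g)(V, W) = g(∇_V T, W) + g(∇_W T, V)` is
O'Neill 1983, Ch. 9, proof of Prop. 9.25, and Wald 1984, (C.2.16). If `T` is not differentiable
at `x` this is the junk value `0`. [cite: ChristodoulouKlainerman1993, Ch. 1 and Ch. 7, §7.1] -/
def deformationTensor (T : Π x : M, TangentSpace I x) (x : M) :
    TangentSpace I x →L[ℝ] TangentSpace I x →L[ℝ] ℝ :=
  letI gx : E →L[ℝ] E →L[ℝ] ℝ := g.val x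
  letI A : E →L[ℝ] E := g.leviCivita T x
  show E →L[ℝ] E →L[ℝ] ℝ from gx.comp A + (gx.flip.comp A).flip

/-- Unfolding lemma: `π_x(V, W) = g_x(∇_V T, W) + g_x(V, ∇_W T)`. O'Neill 1983, Ch. 9, proof of
Prop. 9.25; Wald 1984, (C.2.16). [cite: ONeill1983, Ch. 9, Prop. 9.25] -/
@[simp]
theorem deformationTensor_apply (T : Π x : M, TangentSpace I x) (V₀ W₀ : TangentSpace I x) :
    g.deformationTensor T x V₀ W₀ =
      g.val x (g.leviCivita T x V₀) W₀ + g.val x V₀ (g.leviCivita T x W₀) :=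
  rfl

/-- The deformation tensor is symmetric: `π(V, W) = π(W, V)` (it is the Lie derivative of the
symmetric tensor `g`). O'Neill 1983, Ch. 9, Prop. 9.25. [cite: ONeill1983, Ch. 9, Prop. 9.25] -/
theorem deformationTensor_symm (T : Π x : M, TangentSpace I x) (V₀ W₀ : TangentSpace I x) :
    g.deformationTensor T x V₀ W₀ = g.deformationTensor T x W₀ V₀ := by
  rw [deformationTensor_apply, deformationTensor_apply, g.symm x (g.leviCivita T x V₀) W₀,
    g.symm x V₀ (g.leviCivita T x W₀), add_comm]

/-- The deformation tensor of the zero vector field vanishes. O'Neill 1983, Ch. 9, p. 250.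
[cite: ONeill1983, Ch. 9, p. 250] -/
@[simp]
theorem deformationTensor_zero (x : M) :
    g.deformationTensor (0 : Π x : M, TangentSpace I x) x = 0 := by
  ext V₀ W₀
  simp [g.leviCivita.zero]

/-! ### The Killing `2`-form `K = d(T♭)` -/

/-- The **Killing `2`-form** `K = d(T♭)` of a vector field `T` at `x`, as a continuous bilinear
form on `T_x M`: `K_x(V, W) = g_x(∇_V T, W) − g_x(V, ∇_W T)`, i.e. in index notation
`K_{ab} = ∇_a T_b − ∇_b T_a = 2 ∇_{[a} T_{b]}` — the integrand `∇^{[c} ξ^{d]}` of Komar's integral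
(Wald 1984, (11.2.5)–(11.2.9)); for a Killing field `K = 2 ∇T♭` (Wald 1984, (C.3.1) ff.:
`∇_a ξ_b = ∇_{[a} ξ_{b]}`). If `T` is not differentiable at `x` this is the junk value `0`.
[cite: Wald1984, (11.2.5)–(11.2.9)] -/
def killingTwoForm (T : Π x : M, TangentSpace I x) (x : M) :
    TangentSpace I x →L[ℝ] TangentSpace I x →L[ℝ] ℝ :=
  letI gx : E →L[ℝ] E →L[ℝ] ℝ := g.val x
  letI A : E →L[ℝ] E := g.leviCivita T x
  show E →L[ℝ] E →L[ℝ] ℝ from gx.comp A - (gx.flip.comp A).flip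

/-- Unfolding lemma: `K_x(V, W) = g_x(∇_V T, W) − g_x(V, ∇_W T)`. Wald 1984, (11.2.5).
[cite: Wald1984, (11.2.5)] -/
@[simp]
theorem killingTwoForm_apply (T : Π x : M, TangentSpace I x) (V₀ W₀ : TangentSpace I x) :
    g.killingTwoForm T x V₀ W₀ =
      g.val x (g.leviCivita T x V₀) W₀ - g.val x V₀ (g.leviCivita T x W₀) :=
  rfl

/-- The Killing `2`-form is antisymmetric: `K(V, W) = −K(W, V)`. Wald 1984, (11.2.5) (a
`2`-form). [cite: Wald1984, (11.2.5)] -/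
theorem killingTwoForm_swap (T : Π x : M, TangentSpace I x) (V₀ W₀ : TangentSpace I x) :
    g.killingTwoForm T x V₀ W₀ = -g.killingTwoForm T x W₀ V₀ := by
  rw [killingTwoForm_apply, killingTwoForm_apply, g.symm x (g.leviCivita T x V₀) W₀,
    g.symm x V₀ (g.leviCivita T x W₀)]
  ring

/-- The Killing `2`-form vanishes on the diagonal: `K(V, V) = 0`. Wald 1984, (11.2.5).
[cite: Wald1984, (11.2.5)] -/
@[simp]
theorem killingTwoForm_self (T : Π x : M, TangentSpace I x) (V₀ : TangentSpace I x) :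
    g.killingTwoForm T x V₀ V₀ = 0 := by
  rw [killingTwoForm_apply, g.symm x V₀ (g.leviCivita T x V₀), sub_self]

/-- The Killing `2`-form of the zero vector field vanishes. Wald 1984, (11.2.5).
[cite: Wald1984, (11.2.5)] -/
@[simp]
theorem killingTwoForm_zero (x : M) :
    g.killingTwoForm (0 : Π x : M, TangentSpace I x) x = 0 := by
  ext V₀ W₀
  simp [g.leviCivita.zero]

/-- **`∇T♭ = (π + K) / 2`**: `π(V, W) + K(V, W) = 2 g(∇_V T, W)` — the covariant differential of
`T♭` splits into its symmetric part `π / 2` and its antisymmetric part `K / 2`. Wald 1984, (C.2.16)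
with (11.2.5). [cite: Wald1984, (C.2.16)] -/
theorem deformationTensor_add_killingTwoForm (T : Π x : M, TangentSpace I x)
    (V₀ W₀ : TangentSpace I x) :
    g.deformationTensor T x V₀ W₀ + g.killingTwoForm T x V₀ W₀ =
      2 * g.val x (g.leviCivita T x V₀) W₀ := by
  rw [deformationTensor_apply, killingTwoForm_apply]
  ring

/-- `π(V, W) − K(V, W) = 2 g(V, ∇_W T)`. Wald 1984, (C.2.16) with (11.2.5). [cite: Wald1984, (C.2.16)] -/
theorem deformationTensor_sub_killingTwoForm (T : Π x : M, TangentSpace I x)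
    (V₀ W₀ : TangentSpace I x) :
    g.deformationTensor T x V₀ W₀ - g.killingTwoForm T x V₀ W₀ =
      2 * g.val x V₀ (g.leviCivita T x W₀) := by
  rw [deformationTensor_apply, killingTwoForm_apply]
  ring

/-! ### Killing fields are the vector fields with vanishing deformation tensor -/

section Killing

variable [FiniteDimensional ℝ E] [CompleteSpace E] [Fact (1 ≤ n)]

omit [FiniteDimensional ℝ E] [CompleteSpace E] [Fact (1 ≤ n)] in
/-- **Killing iff `𝓛_T g = 0`.** A vector field is a Killing field of `g` (`IsKillingField`:
`C^n` and `∇T` is `g`-skew) iff it is `C^n` and its deformation tensor vanishes identically.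
O'Neill 1983, Ch. 9, Def. 9.22 and Prop. 9.25; Christodoulou–Klainerman 1993, Ch. 1,
footnote 22. [cite: ONeill1983, Ch. 9, Def. 9.22 and Prop. 9.25] -/
theorem isKillingField_iff_deformationTensor_eq_zero (T : Π x : M, TangentSpace I x) :
    g.IsKillingField T ↔ CMDiff n (T% T) ∧ ∀ x : M, g.deformationTensor T x = 0 := by
  refine and_congr_right fun _ ↦ forall_congr' fun x ↦ ?_
  constructor
  · intro h
    ext V₀ W₀
    simpa using h V₀ W₀
  · intro h V₀ W₀
    simpa using congrArg (fun B : TangentSpace I x →L[ℝ] TangentSpace I x →L[ℝ] ℝ ↦ B V₀ W₀) h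

variable {g} in
omit [FiniteDimensional ℝ E] [CompleteSpace E] [Fact (1 ≤ n)] in
/-- The deformation tensor of a Killing field vanishes. O'Neill 1983, Ch. 9, Prop. 9.25.
[cite: ONeill1983, Ch. 9, Prop. 9.25] -/
theorem IsKillingField.deformationTensor_eq_zero {T : Π x : M, TangentSpace I x}
    (h : g.IsKillingField T) (x : M) : g.deformationTensor T x = 0 :=
  (((g.isKillingField_iff_deformationTensor_eq_zero T).mp h).2 x)

variable {g} in
omit [FiniteDimensional ℝ E] [CompleteSpace E] [Fact (1 ≤ n)] in
/-- For a Killing field the Killing `2`-form is twice the covariant differential: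
`K(V, W) = 2 g(∇_V T, W)` (Wald 1984, below (11.2.4): `∇_a ξ_b = ∇_{[a} ξ_{b]}`).
[cite: Wald1984, (11.2.5)] -/
theorem IsKillingField.killingTwoForm_apply {T : Π x : M, TangentSpace I x}
    (h : g.IsKillingField T) (x : M) (V₀ W₀ : TangentSpace I x) :
    g.killingTwoForm T x V₀ W₀ = 2 * g.val x (g.leviCivita T x V₀) W₀ := by
  have h0 : g.deformationTensor T x V₀ W₀ = 0 := by
    rw [h.deformationTensor_eq_zero x]; rfl
  have := g.deformationTensor_add_killingTwoForm T V₀ W₀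
  rwa [h0, zero_add] at this

end Killing

end PseudoRiemannianMetric

/-! ### The Killing defect on a spacetime and its size on chart slabs -/

namespace Spacetime

variable {d : ℕ} in
/-- The **Killing defect** `π = 𝓛_T g` of a vector field `T` on the spacetime `𝓢`: the
deformation tensor of `T` for `𝓢.metric` (`PseudoRiemannianMetric.deformationTensor`), a
continuous bilinear form on each tangent space; `T` is Killing iff it is smooth and `π = 0`.
Christodoulou–Klainerman 1993, Ch. 1; Anderson, AHP 1 (2000), §0 (`𝓛_X g = 0`). Standing
hypothesis `[𝓢.metric.HasLeviCivita]`. [cite: ChristodoulouKlainerman1993, Ch. 1] -/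
abbrev killingDefect (𝓢 : Spacetime.{u} d) [𝓢.metric.HasLeviCivita]
    (T : Π p : 𝓢.carrier, TangentSpace (𝓡 d) p) (p : 𝓢.carrier) :
    TangentSpace (𝓡 d) p →L[ℝ] TangentSpace (𝓡 d) p →L[ℝ] ℝ :=
  𝓢.metric.deformationTensor T p

variable (𝓢 : Spacetime.{u} 4) [𝓢.metric.HasLeviCivita] (B : ModelBackground)

/-- The **chart components of the Killing defect**: the pullback `(Ψ^* π)(x)` at `x ∈ U = B.domain`
of the deformation tensor `π = 𝓛_T g` along the chart map `Ψ : U → 𝓢.carrier`, a continuous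
bilinear map on `E4` (the tangent space of the open set `U ⊆ E4` at `x` is `E4` definitionally);
`(Ψ^* π)(x)(e_μ, e_ν) = π_{μν}` are the components of `π` in the chart. Christodoulou–Klainerman
1993, Ch. 1 (deformation tensor); DHRT arXiv:2104.08222, §1 (tensors measured in a late-time chart).
[cite: ChristodoulouKlainerman1993, Ch. 1] -/
def chartKillingDefect (Ψ : B.domain → 𝓢.carrier) (T : Π p : 𝓢.carrier, TangentSpace (𝓡 4) p)
    (x : B.domain) : E4 →L[ℝ] E4 →L[ℝ] ℝ :=
  show E4 →L[ℝ] E4 →L[ℝ] ℝ from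
    pullbackBilin (I := 𝓡 4) (I' := 𝓘(ℝ, E4)) Ψ (𝓢.killingDefect T) x

/-- Unfolding lemma: `(Ψ^* π)(x)(v, w) = π_{Ψ x}(dΨ_x v, dΨ_x w)`. O'Neill 1983, Ch. 3, Def. 3.9
(pullback). [cite: ONeill1983, Ch. 3, Def. 3.9] -/
theorem chartKillingDefect_apply (Ψ : B.domain → 𝓢.carrier)
    (T : Π p : 𝓢.carrier, TangentSpace (𝓡 4) p) (x : B.domain) (v w : E4) :
    𝓢.chartKillingDefect B Ψ T x v w =
      𝓢.killingDefect T (Ψ x) (mfderiv 𝓘(ℝ, E4) (𝓡 4) Ψ x v) (mfderiv 𝓘(ℝ, E4) (𝓡 4) Ψ x w) :=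
  rfl

/-- The chart components of the Killing defect of a Killing field vanish. O'Neill 1983, Ch. 9,
Prop. 9.25. [cite: ONeill1983, Ch. 9, Prop. 9.25] -/
theorem chartKillingDefect_eq_zero_of_isKillingField (Ψ : B.domain → 𝓢.carrier)
    {T : Π p : 𝓢.carrier, TangentSpace (𝓡 4) p} (hT : 𝓢.metric.IsKillingField T) :
    𝓢.chartKillingDefect B Ψ T = 0 := by
  funext x
  ext v w
  rw [chartKillingDefect_apply, killingDefect, hT.deformationTensor_eq_zero (Ψ x)]
  rfl

/-- The chart components of the Killing defect extended by zero to all of `E4`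
(`Function.extend Subtype.val · 0`, as `Spacetime.deviationExtend`), so that Mathlib's
`iteratedFDeriv ℝ m` applies; on the open set `U` its derivatives are the honest coordinate
derivatives `∂^m π_{μν}`. DHRT arXiv:2104.08222, §1. [cite: arXiv210408222, §1] -/
def chartKillingDefectExtend (Ψ : B.domain → 𝓢.carrier)
    (T : Π p : 𝓢.carrier, TangentSpace (𝓡 4) p) : E4 → E4 →L[ℝ] E4 →L[ℝ] ℝ :=
  Function.extend Subtype.val (𝓢.chartKillingDefect B Ψ T) 0

/-- On the domain, the extension agrees with the chart components. DHRT arXiv:2104.08222, §1.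
[cite: arXiv210408222, §1] -/
@[simp]
theorem chartKillingDefectExtend_coe (Ψ : B.domain → 𝓢.carrier)
    (T : Π p : 𝓢.carrier, TangentSpace (𝓡 4) p) (x : B.domain) :
    𝓢.chartKillingDefectExtend B Ψ T x = 𝓢.chartKillingDefect B Ψ T x :=
  Subtype.val_injective.extend_apply _ _ x

/-- Off the domain, the extension is the junk value `0` (never used). DHRT arXiv:2104.08222, §1.
[cite: arXiv210408222, §1] -/
theorem chartKillingDefectExtend_of_not_mem (Ψ : B.domain → 𝓢.carrier)
    (T : Π p : 𝓢.carrier, TangentSpace (𝓡 4) p) {y : E4} (hy : y ∉ B.domain) :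
    𝓢.chartKillingDefectExtend B Ψ T y = 0 := by
  rw [chartKillingDefectExtend, Function.extend_apply']
  · rfl
  · rintro ⟨x, rfl⟩
    exact hy x.2

/-- The extension of the chart components of a Killing field is identically zero.
O'Neill 1983, Ch. 9, Prop. 9.25. [cite: ONeill1983, Ch. 9, Prop. 9.25] -/
theorem chartKillingDefectExtend_eq_zero_of_isKillingField (Ψ : B.domain → 𝓢.carrier)
    {T : Π p : 𝓢.carrier, TangentSpace (𝓡 4) p} (hT : 𝓢.metric.IsKillingField T) :
    𝓢.chartKillingDefectExtend B Ψ T = 0 := by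
  funext y
  by_cases hy : y ∈ B.domain
  · rw [show y = ((⟨y, hy⟩ : B.domain) : E4) from rfl, chartKillingDefectExtend_coe,
      𝓢.chartKillingDefect_eq_zero_of_isKillingField B Ψ hT]
    rfl
  · exact 𝓢.chartKillingDefectExtend_of_not_mem B Ψ T hy

/-! #### `Cᵏ` sup norm of the Killing defect on a truncated slab -/

/-- The **`Cᵏ` Killing defect of `T` on the truncated slab `{t = τ, r ≤ R}`** of the chart `Ψ`:
`sup_{m ≤ k} sup_{x ∈ U, t(x) = τ, r(x) ≤ R} ‖D^m (Ψ^* π)(x)‖ ∈ [0, ∞]`, the `Cᵏ` sup norm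
(`supCkENorm`, operator norms, `iteratedFDeriv`) of the chart components of `π = 𝓛_T g` over
the coordinate image of `B.truncTimeSlab R τ` — for `k = 1` the sup of `|π_{μν}|` and
`|∂_λ π_{μν}|`. Christodoulou–Klainerman 1993, Ch. 1, footnote 23 ("almost Killing": deformation
tensor small); DHRT arXiv:2104.08222, §1 (`Cᵏ` sup norms on `{t* = τ} ∩ {r ≤ R}`); the exactly
stationary case `π = 0` is Anderson, AHP 1 (2000), §0. [cite: ChristodoulouKlainerman1993, Ch. 1, footnote 23] -/
def killingDefectCk (Ψ : B.domain → 𝓢.carrier) (T : Π p : 𝓢.carrier, TangentSpace (𝓡 4) p)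
    (k : ℕ) (R τ : ℝ) : ℝ≥0∞ :=
  supCkENorm (Subtype.val '' B.truncTimeSlab R τ) k (𝓢.chartKillingDefectExtend B Ψ T)

/-- The `Cᵏ` Killing defect is monotone in `k`. DHRT arXiv:2104.08222, §1. [cite: arXiv210408222, §1] -/
theorem killingDefectCk_mono_right (Ψ : B.domain → 𝓢.carrier)
    (T : Π p : 𝓢.carrier, TangentSpace (𝓡 4) p) {k k' : ℕ} (h : k ≤ k') (R τ : ℝ) :
    𝓢.killingDefectCk B Ψ T k R τ ≤ 𝓢.killingDefectCk B Ψ T k' R τ :=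
  supCkENorm_mono_right _ h _

/-- The `Cᵏ` Killing defect is monotone in the truncation radius `R`. DHRT arXiv:2104.08222,
§1. [cite: arXiv210408222, §1] -/
theorem killingDefectCk_mono (Ψ : B.domain → 𝓢.carrier)
    (T : Π p : 𝓢.carrier, TangentSpace (𝓡 4) p) (k : ℕ) {R R' : ℝ} (h : R ≤ R') (τ : ℝ) :
    𝓢.killingDefectCk B Ψ T k R τ ≤ 𝓢.killingDefectCk B Ψ T k R' τ :=
  supCkENorm_mono (Set.image_mono (B.truncTimeSlab_mono h τ)) _ _

/-- The `Cᵏ` Killing defect of a Killing field vanishes on every slab (exact stationarity has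
zero defect). O'Neill 1983, Ch. 9, Prop. 9.25; Anderson, AHP 1 (2000), §0.
[cite: ONeill1983, Ch. 9, Prop. 9.25] -/
theorem killingDefectCk_eq_zero_of_isKillingField (Ψ : B.domain → 𝓢.carrier)
    {T : Π p : 𝓢.carrier, TangentSpace (𝓡 4) p} (hT : 𝓢.metric.IsKillingField T) (k : ℕ)
    (R τ : ℝ) : 𝓢.killingDefectCk B Ψ T k R τ = 0 := by
  rw [killingDefectCk, 𝓢.chartKillingDefectExtend_eq_zero_of_isKillingField B Ψ hT,
    supCkENorm_zero]

/-! #### Weighted `W^{k,1}` size of the Killing defect on a truncated slab -/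

/-- The **weighted `W^{k,1}` Killing defect of `T` on the truncated slab `{t = τ, r ≤ R}`** of the
chart `Ψ`: `∫_{x ∈ U, t(x) = τ, r(x) ≤ R} w(x) · ∑_{m ≤ k} ‖D^m (Ψ^* π)(x)‖ dμHE[3](x) ∈ [0, ∞]`,
the integral over the coordinate image of `B.truncTimeSlab R τ ⊆ E4` with respect to the
Euclidean-normalised `3`-dimensional Hausdorff measure `μHE[3]` of `E4` (Lebesgue surface measure
on the coordinate hyperplane `{x⁰ = τ}` for the Kerr / Minkowski backgrounds), with weight
`w : E4 → ℝ≥0∞` (`w = 1`: the plain `W^{k,1}` seminorm; `k = 1`: `∫ w (|π| + |∂π|)`).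
Christodoulou–Klainerman 1993, Ch. 1, footnote 23 ("almost Killing": deformation tensor small in
an appropriate norm); Bartnik, CPAM 39 (1986), (1.2) (weighted Sobolev norms in a chart).
[cite: ChristodoulouKlainerman1993, Ch. 1, footnote 23] -/
def killingDefectL1 (Ψ : B.domain → 𝓢.carrier) (T : Π p : 𝓢.carrier, TangentSpace (𝓡 4) p)
    (w : E4 → ℝ≥0∞) (k : ℕ) (R τ : ℝ) : ℝ≥0∞ :=
  ∫⁻ y in Subtype.val '' B.truncTimeSlab R τ,
    w y * ∑ m ∈ Finset.range (k + 1), ‖iteratedFDeriv ℝ m (𝓢.chartKillingDefectExtend B Ψ T) y‖ₑ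
      ∂μHE[3]

/-- The weighted `W^{k,1}` Killing defect is monotone in the truncation radius `R`.
Bartnik 1986, (1.2). [cite: Bartnik1986, (1.2)] -/
theorem killingDefectL1_mono (Ψ : B.domain → 𝓢.carrier)
    (T : Π p : 𝓢.carrier, TangentSpace (𝓡 4) p) (w : E4 → ℝ≥0∞) (k : ℕ) {R R' : ℝ}
    (h : R ≤ R') (τ : ℝ) :
    𝓢.killingDefectL1 B Ψ T w k R τ ≤ 𝓢.killingDefectL1 B Ψ T w k R' τ :=
  lintegral_mono_set (Set.image_mono (B.truncTimeSlab_mono h τ))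

/-- The weighted `W^{k,1}` Killing defect is monotone in the weight. Bartnik 1986, (1.2).
[cite: Bartnik1986, (1.2)] -/
theorem killingDefectL1_mono_weight (Ψ : B.domain → 𝓢.carrier)
    (T : Π p : 𝓢.carrier, TangentSpace (𝓡 4) p) {w w' : E4 → ℝ≥0∞} (h : w ≤ w') (k : ℕ)
    (R τ : ℝ) :
    𝓢.killingDefectL1 B Ψ T w k R τ ≤ 𝓢.killingDefectL1 B Ψ T w' k R τ :=
  lintegral_mono fun y ↦ mul_le_mul' (h y) le_rfl

/-- The weighted `W^{k,1}` Killing defect of a Killing field vanishes on every slab.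
O'Neill 1983, Ch. 9, Prop. 9.25; Anderson, AHP 1 (2000), §0. [cite: ONeill1983, Ch. 9, Prop. 9.25] -/
theorem killingDefectL1_eq_zero_of_isKillingField (Ψ : B.domain → 𝓢.carrier)
    {T : Π p : 𝓢.carrier, TangentSpace (𝓡 4) p} (hT : 𝓢.metric.IsKillingField T)
    (w : E4 → ℝ≥0∞) (k : ℕ) (R τ : ℝ) : 𝓢.killingDefectL1 B Ψ T w k R τ = 0 := by
  simp [killingDefectL1, 𝓢.chartKillingDefectExtend_eq_zero_of_isKillingField B Ψ hT]

/-! #### `ε`-stationarity on a truncated slab -/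

/-- **`T` is `ε`-stationary in `Cᵏ` on the truncated slab `{t = τ, r ≤ R}` of the chart `Ψ`**:
`T` is a smooth vector field on `𝓢` (as a section of the tangent bundle) and the `Cᵏ` sup norm of
the chart components of its Killing defect `π = 𝓛_T g` over `Ψ({t = τ} ∩ {r ≤ R})` is at most
`ε` (`killingDefectCk … k R τ ≤ ε`). The requested notion is `k = 1` (`π` and `∂π` pointwise
`≤ ε`); `ε : ℝ≥0∞` as for `Spacetime.RemainsCloseTo` (`ε = ∞` vacuous, `ε = 0`: `T` is Killing
along the slab to order `k`). An "almost Killing" / approximately stationary vector field in the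
sense of Christodoulou–Klainerman 1993, Ch. 1, footnote 23 (deformation tensor small), measured in
the late-time charts of DHRT arXiv:2104.08222, §1; for `π = 0` and `T` timelike this is
stationarity (Anderson, AHP 1 (2000), §0). Meant for late-time charts `Ψ` (`IsLateChart`).
[cite: ChristodoulouKlainerman1993, Ch. 1, footnote 23] -/
def IsEpsStationaryOn (Ψ : B.domain → 𝓢.carrier) (T : Π p : 𝓢.carrier, TangentSpace (𝓡 4) p)
    (k : ℕ) (R τ : ℝ) (ε : ℝ≥0∞) : Prop :=
  ContMDiff (𝓡 4) (𝓡 4).tangent ∞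
      (fun p ↦ (TotalSpace.mk' (EuclideanSpace ℝ (Fin 4)) p (T p) : TangentBundle (𝓡 4) 𝓢.carrier)) ∧
    𝓢.killingDefectCk B Ψ T k R τ ≤ ε

/-- **`T` is `ε`-stationary in weighted `W^{k,1}` on the truncated slab `{t = τ, r ≤ R}` of the
chart `Ψ`**: `T` is smooth and the weighted `W^{k,1}` size of the chart components of `π = 𝓛_T g`
over `Ψ({t = τ} ∩ {r ≤ R})` is at most `ε` (`killingDefectL1 … w k R τ ≤ ε`; `k = 1`:
`∫ w (|π| + |∂π|) ≤ ε`). Christodoulou–Klainerman 1993, Ch. 1, footnote 23; Bartnik 1986, (1.2).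
[cite: ChristodoulouKlainerman1993, Ch. 1, footnote 23] -/
def IsEpsStationaryL1On (Ψ : B.domain → 𝓢.carrier) (T : Π p : 𝓢.carrier, TangentSpace (𝓡 4) p)
    (w : E4 → ℝ≥0∞) (k : ℕ) (R τ : ℝ) (ε : ℝ≥0∞) : Prop :=
  ContMDiff (𝓡 4) (𝓡 4).tangent ∞
      (fun p ↦ (TotalSpace.mk' (EuclideanSpace ℝ (Fin 4)) p (T p) : TangentBundle (𝓡 4) 𝓢.carrier)) ∧
    𝓢.killingDefectL1 B Ψ T w k R τ ≤ ε

variable {𝓢 B}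

/-- An `ε`-stationary vector field is smooth. [folklore] -/
theorem IsEpsStationaryOn.contMDiff {Ψ : B.domain → 𝓢.carrier}
    {T : Π p : 𝓢.carrier, TangentSpace (𝓡 4) p} {k : ℕ} {R τ : ℝ} {ε : ℝ≥0∞}
    (h : 𝓢.IsEpsStationaryOn B Ψ T k R τ ε) :
    ContMDiff (𝓡 4) (𝓡 4).tangent ∞
      (fun p ↦ (TotalSpace.mk' (EuclideanSpace ℝ (Fin 4)) p (T p) : TangentBundle (𝓡 4) 𝓢.carrier)) :=
  h.1

/-- The defect bound of an `ε`-stationary vector field. [folklore] -/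
theorem IsEpsStationaryOn.killingDefectCk_le {Ψ : B.domain → 𝓢.carrier}
    {T : Π p : 𝓢.carrier, TangentSpace (𝓡 4) p} {k : ℕ} {R τ : ℝ} {ε : ℝ≥0∞}
    (h : 𝓢.IsEpsStationaryOn B Ψ T k R τ ε) : 𝓢.killingDefectCk B Ψ T k R τ ≤ ε :=
  h.2

/-- `ε`-stationarity is monotone in `ε`. [folklore] -/
theorem IsEpsStationaryOn.mono {Ψ : B.domain → 𝓢.carrier}
    {T : Π p : 𝓢.carrier, TangentSpace (𝓡 4) p} {k : ℕ} {R τ : ℝ} {ε ε' : ℝ≥0∞}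
    (h : 𝓢.IsEpsStationaryOn B Ψ T k R τ ε) (hε : ε ≤ ε') : 𝓢.IsEpsStationaryOn B Ψ T k R τ ε' :=
  ⟨h.1, h.2.trans hε⟩

/-- `ε`-stationarity on `{r ≤ R'}` implies it on the smaller ball `{r ≤ R}`, `R ≤ R'`, and in
`Cᵏ` for smaller `k`. [folklore] -/
theorem IsEpsStationaryOn.of_le {Ψ : B.domain → 𝓢.carrier}
    {T : Π p : 𝓢.carrier, TangentSpace (𝓡 4) p} {k k' : ℕ} {R R' τ : ℝ} {ε : ℝ≥0∞}
    (h : 𝓢.IsEpsStationaryOn B Ψ T k' R' τ ε) (hk : k ≤ k') (hR : R ≤ R') :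
    𝓢.IsEpsStationaryOn B Ψ T k R τ ε :=
  ⟨h.1, ((𝓢.killingDefectCk_mono_right B Ψ T hk R τ).trans
    (𝓢.killingDefectCk_mono B Ψ T k' hR τ)).trans h.2⟩

/-- **Exactly stationary is `ε`-stationary for every `ε`**: a Killing field of the spacetime is
`ε`-stationary in every `Cᵏ`, on every slab of every chart, for every `ε ≥ 0`. O'Neill 1983,
Ch. 9, Prop. 9.25; Anderson, AHP 1 (2000), §0. [cite: ONeill1983, Ch. 9, Prop. 9.25] -/
theorem isEpsStationaryOn_of_isKillingField (Ψ : B.domain → 𝓢.carrier)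
    {T : Π p : 𝓢.carrier, TangentSpace (𝓡 4) p} (hT : 𝓢.metric.IsKillingField T) (k : ℕ)
    (R τ : ℝ) (ε : ℝ≥0∞) : 𝓢.IsEpsStationaryOn B Ψ T k R τ ε :=
  ⟨hT.contMDiff, by rw [𝓢.killingDefectCk_eq_zero_of_isKillingField B Ψ hT]; exact zero_le⟩

/-- An `ε`-stationary (in `W^{k,1}`) vector field is smooth. [folklore] -/
theorem IsEpsStationaryL1On.contMDiff {Ψ : B.domain → 𝓢.carrier}
    {T : Π p : 𝓢.carrier, TangentSpace (𝓡 4) p} {w : E4 → ℝ≥0∞} {k : ℕ} {R τ : ℝ} {ε : ℝ≥0∞}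
    (h : 𝓢.IsEpsStationaryL1On B Ψ T w k R τ ε) :
    ContMDiff (𝓡 4) (𝓡 4).tangent ∞
      (fun p ↦ (TotalSpace.mk' (EuclideanSpace ℝ (Fin 4)) p (T p) : TangentBundle (𝓡 4) 𝓢.carrier)) :=
  h.1

/-- The defect bound of an `ε`-stationary (in `W^{k,1}`) vector field. [folklore] -/
theorem IsEpsStationaryL1On.killingDefectL1_le {Ψ : B.domain → 𝓢.carrier}
    {T : Π p : 𝓢.carrier, TangentSpace (𝓡 4) p} {w : E4 → ℝ≥0∞} {k : ℕ} {R τ : ℝ} {ε : ℝ≥0∞}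
    (h : 𝓢.IsEpsStationaryL1On B Ψ T w k R τ ε) : 𝓢.killingDefectL1 B Ψ T w k R τ ≤ ε :=
  h.2

/-- `W^{k,1}`-`ε`-stationarity is monotone in `ε` and antitone in the radius and the weight.
[folklore] -/
theorem IsEpsStationaryL1On.mono {Ψ : B.domain → 𝓢.carrier}
    {T : Π p : 𝓢.carrier, TangentSpace (𝓡 4) p} {w w' : E4 → ℝ≥0∞} {k : ℕ} {R R' τ : ℝ}
    {ε ε' : ℝ≥0∞} (h : 𝓢.IsEpsStationaryL1On B Ψ T w' k R' τ ε) (hw : w ≤ w') (hR : R ≤ R')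
    (hε : ε ≤ ε') : 𝓢.IsEpsStationaryL1On B Ψ T w k R τ ε' :=
  ⟨h.1, (((𝓢.killingDefectL1_mono_weight B Ψ T hw k R τ).trans
    (𝓢.killingDefectL1_mono B Ψ T w' k hR τ)).trans h.2).trans hε⟩

/-- A Killing field of the spacetime is `ε`-stationary in weighted `W^{k,1}` on every slab, for
every weight and every `ε ≥ 0`. O'Neill 1983, Ch. 9, Prop. 9.25; Anderson, AHP 1 (2000), §0.
[cite: ONeill1983, Ch. 9, Prop. 9.25] -/
theorem isEpsStationaryL1On_of_isKillingField (Ψ : B.domain → 𝓢.carrier)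
    {T : Π p : 𝓢.carrier, TangentSpace (𝓡 4) p} (hT : 𝓢.metric.IsKillingField T)
    (w : E4 → ℝ≥0∞) (k : ℕ) (R τ : ℝ) (ε : ℝ≥0∞) : 𝓢.IsEpsStationaryL1On B Ψ T w k R τ ε :=
  ⟨hT.contMDiff, by rw [𝓢.killingDefectL1_eq_zero_of_isKillingField B Ψ hT]; exact zero_le⟩

end Spacetime

end Literature.Geometry.Lorentzian

end
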